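import Literature.NumberTheory.LFunctions.DirichletConvOneChiSum
import HarnessLib

/-!
# `∑_{n ≤ N} (1 ∗ χ)(n)/n = (log N + γ) L(1, χ) + L'(1, χ) + ϑ·(P(2 log N + γ + 1)/(Y+1) + 2Y/N)`
# with the INTERVAL character-sum bound `P` and sharp constants (Pintz 1976 II, proof of Lemma 1)

Topic `Literature/NumberTheory/LFunctions` (namespace `Literature.NumberTheory.LFunctions.DirichletAbel`, as
the companion file `DirichletConvOneChiSum.lean`). Everything in this file is PROVED (theorems only; no
definition, no named fact).

`DirichletConvOneChiSum.lean` proves Montgomery–Vaughan's Exercise 11.2.3(g) in the form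
`|∑_{n ≤ N} r(n)/n − ((log N + γ)L(1,χ) + L'(1,χ))| ≤ 8B(log N + 1)/(Y+1) + 4Y/N` with a bound `B` on the
INITIAL partial sums `S(n) = ∑_{m ≤ n} χ(m)`. For Pintz's Lemma 1 (Acta Arith. 31 (1976) p. 279 (2.1):
"`Σ_{n ≤ x} g(n)/n = L'(1) + (log x + c)L(1) + 5ϑ√(√D log D log x/x)`", proof p. 280 by "Pólya's inequality
`|Σ_{d=a}^{b} χ_D(d)| ≤ (5/3)√D log D` … and Abel's inequality" applied to the three monotone weights `1/d`,
`log d/d`, `(1/d)Σ_{m ≤ x/d} 1/m`) the constants matter, and the natural input is a bound `P` on ALL interval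
sums `|∑_{a < n ≤ b} χ(n)| ≤ P`. With it Abel's inequality costs `P·f(Y+1)` (not `2B·f(Y+1)`) for a
non-increasing weight `f`, and the three weights of the hyperbola method give (this file's main result,
`norm_sum_divisorSum_div_sub_le_interval`): for `χ ≠ χ₀` mod `q`, integers `2 ≤ Y < N`,

`‖∑_{n ≤ N} r(n)/n − ((log N + γ)L(1,χ) + L'(1,χ))‖ ≤ P(2 log N + γ + 1)/(Y+1) + 2Y/N`,

the `log(Y+1)` contributions of the `log d/d`-tail and of the hyperbola tail cancelling exactly (Pintz p. 280:
`(log x + c)P/z + P log z/z + P log x/z + z/x` with his `H(x/z) ≤ log x`; here `H(⌊N/(Y+1)⌋) ≤ 1 + log N −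
log(Y+1)` and the harmonic remainder `|H(⌊N/d⌋) − log(N/d) − γ| ≤ 1/⌊N/d⌋ < 2d/N`).

## Contents

* `norm_partialSum_sub_le_of_interval` — `‖S(n) − S(m)‖ ≤ P` from the interval bound;
* `norm_sum_Icc_div_sub_LFunction_one_le_interval` — `‖∑_{d ≤ M} χ(d)/d − L(1,χ)‖ ≤ P/(M+1)`;
* `norm_sum_Icc_log_div_add_deriv_le_interval` — `‖∑_{d ≤ M} χ(d) log d/d + L'(1,χ)‖ ≤ P log(M+1)/(M+1)`
  (`M ≥ 2`);
* `norm_sum_Ioc_mul_le_of_antitone` — Abel's inequality `‖∑_{Y < d ≤ N} χ(d) f(d)‖ ≤ P f(Y+1)` for a weight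
  non-increasing on `(Y, N+1]` with `f(N+1) ≥ 0`;
* `norm_head_sub_le_two` — the head `d ≤ Y` against `(log x + γ)∑χ(d)/d − ∑χ(d)log d/d`, error `2Y/x`
  (from `|H(⌊x/d⌋) − (log(x/d) + γ)| ≤ 2d/x`);
* `norm_tail_le_interval` — Pintz's `Σ₂`: `‖∑_{Y < d ≤ N}(χ(d)/d)H(⌊N/d⌋)‖ ≤ P(1 + log N − log(Y+1))/(Y+1)`;
* `norm_sum_divisorSum_div_sub_le_interval_real` / `…_interval` — the displayed estimate for real
  `x` (sum over `n ≤ ⌊x⌋`, main term `(log x + γ)L(1,χ) + L'(1,χ)`, error `P(2 log x + γ + 1)/(Y+1) +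
  2Y/x` for `2 ≤ Y ≤ x`) and at integers.

## References

* [Pintz1976ElementaryII] J. Pintz, Acta Arith. 31 (1976) 273–289, Lemma 1 p. 279 (2.1) and its proof p. 280.
* [MontgomeryVaughan2007] §11.2.1 Exercise 3 (c)–(g); §1.3 Thm 1.3 (Abel summation).
-/

noncomputable section

open Complex Filter Topology Finset

namespace Literature.NumberTheory.LFunctions.DirichletAbel

variable {q : ℕ} [NeZero q] (χ : DirichletCharacter ℂ q)

/-! ### Interval bounds and the partial sums -/

omit [NeZero q] in
/-- `S(n) − S(m) = ∑_{m < k ≤ n} χ(k)` for `m ≤ n`. [folklore] -/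
private theorem partialSum_sub_eq_sum_Ioc {m n : ℕ} (hmn : m ≤ n) :
    partialSum χ n - partialSum χ m = ∑ k ∈ Ioc m n, χ (k : ZMod q) := by
  rw [partialSum_eq_sum_Ioc, partialSum_eq_sum_Ioc, zero_add, zero_add,
    ← Finset.sum_Ioc_consecutive _ (Nat.zero_le m) hmn]
  ring

omit [NeZero q] in
/-- With `|∑_{a < k ≤ b} χ(k)| ≤ P` for all `a, b`: `‖S(n) − S(m)‖ ≤ P` for all `m, n`, `‖S(n)‖ ≤ P`, and
`0 ≤ P`. [folklore] -/
private theorem norm_partialSum_sub_le_of_interval {P : ℝ}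
    (hP : ∀ a b : ℕ, ‖∑ k ∈ Ioc a b, χ (k : ZMod q)‖ ≤ P) (m n : ℕ) :
    ‖partialSum χ n - partialSum χ m‖ ≤ P := by
  rcases le_total m n with h | h
  · rw [partialSum_sub_eq_sum_Ioc χ h]; exact hP m n
  · rw [norm_sub_rev, partialSum_sub_eq_sum_Ioc χ h]; exact hP n m

omit [NeZero q] in
/-- `‖S(n)‖ ≤ P` under the interval bound. [folklore] -/
private theorem norm_partialSum_le_of_interval {P : ℝ}
    (hP : ∀ a b : ℕ, ‖∑ k ∈ Ioc a b, χ (k : ZMod q)‖ ≤ P) (n : ℕ) : ‖partialSum χ n‖ ≤ P := by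
  have h := norm_partialSum_sub_le_of_interval χ hP 0 n
  rwa [partialSum_zero, sub_zero] at h

omit [NeZero q] in
/-- `0 ≤ P` under the interval bound. [folklore] -/
private theorem interval_bound_nonneg {P : ℝ}
    (hP : ∀ a b : ℕ, ‖∑ k ∈ Ioc a b, χ (k : ZMod q)‖ ≤ P) : 0 ≤ P :=
  (norm_nonneg _).trans (hP 0 0)

/-! ### The tail of `∑ χ(n)/n` with the interval bound -/

/-- **`‖∑_{d=1}^{M} χ(d)/d − L(1,χ)‖ ≤ P/(M+1)`** for `χ ≠ χ₀` with all interval sums bounded by `P`: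
`∑_{d ≤ M} χ(d)/d − L(1,χ) = S(M)/(M+1) − ∑_{n ≥ M} S(n+1)(1/(n+1) − 1/(n+2))
= ∑_{n ≥ M} (S(M) − S(n+1))(1/(n+1) − 1/(n+2))` and `‖S(M) − S(n+1)‖ ≤ P`.
[cite: Pintz1976ElementaryII, Lemma 1 (proof, p. 280)] [cite: MontgomeryVaughan2007, §11.2.1 Exercise 3(a)] -/
theorem norm_sum_Icc_div_sub_LFunction_one_le_interval (hχ : χ ≠ 1) {P : ℝ}
    (hP : ∀ a b : ℕ, ‖∑ k ∈ Ioc a b, χ (k : ZMod q)‖ ≤ P) (M : ℕ) :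
    ‖(∑ d ∈ Icc 1 M, χ (d : ZMod q) / (d : ℂ)) - χ.LFunction 1‖ ≤ P / ((M : ℝ) + 1) := by
  have hP0 := interval_bound_nonneg χ hP
  have h1 : (0 : ℝ) < (1 : ℂ).re := by simp
  -- rewrite the finite sum as in the companion file
  have hsumIcc : ∑ d ∈ Icc 1 M, χ (d : ZMod q) / (d : ℂ) =
      ∑ n ∈ range M, χ ((n + 1 : ℕ) : ZMod q) * ((n + 1 : ℕ) : ℂ) ^ (-(1 : ℂ)) := by
    rw [sum_Icc_one_eq_sum_range]
    refine sum_congr rfl fun n _ => ?_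
    rw [cpow_neg_one]; push_cast; ring
  have hL : χ.LFunction 1 = ∑' n : ℕ, term χ n 1 := LFunction_eq_abelSum χ hχ h1
  have hsplit : ∑' n : ℕ, term χ n 1 = (∑ n ∈ range M, term χ n 1) + ∑' n : ℕ, term χ (n + M) 1 :=
    ((summable_term χ hχ h1).sum_add_tsum_nat_add M).symm
  rw [hsumIcc, sum_apply_mul_cpow_eq χ 1 M, hL, hsplit, cpow_neg_one]
  have hcalc : partialSum χ M * ((M + 1 : ℕ) : ℂ)⁻¹ + ∑ n ∈ range M, term χ n 1 -
      ((∑ n ∈ range M, term χ n 1) + ∑' n : ℕ, term χ (n + M) 1) =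
      partialSum χ M * ((M + 1 : ℕ) : ℂ)⁻¹ - ∑' n : ℕ, term χ (n + M) 1 := by ring
  rw [hcalc]
  -- the telescoping weights
  set c : ℕ → ℝ := fun n => 1 / ((n + M : ℕ) + 1 : ℝ) - 1 / ((n + M : ℕ) + 2 : ℝ) with hc
  have hc0 : ∀ n, 0 ≤ c n := fun n => by
    simp only [hc]; rw [sub_nonneg]; exact one_div_le_one_div_of_le (by positivity) (by linarith)
  have hcsum : HasSum c (1 / ((M : ℝ) + 1)) := hasSum_telescope M
  -- `term χ (n+M) 1 = S(n+M+1) · c n`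
  have hterm : ∀ n, term χ (n + M) 1 = partialSum χ (n + M + 1) * ((c n : ℝ) : ℂ) := by
    intro n
    rw [term_one_eq]
    simp only [hc]
    push_cast
    ring
  -- `S(M)/(M+1) = ∑' S(M) c n`
  have hS : HasSum (fun n => partialSum χ M * ((c n : ℝ) : ℂ)) (partialSum χ M * ((M + 1 : ℕ) : ℂ)⁻¹) := by
    have h := (Complex.hasSum_ofReal.mpr hcsum).mul_left (partialSum χ M)
    have e : (((1 / ((M : ℝ) + 1) : ℝ)) : ℂ) = ((M + 1 : ℕ) : ℂ)⁻¹ := by push_cast; rw [one_div]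
    rw [e] at h
    exact h
  have hT : HasSum (fun n => term χ (n + M) 1) (∑' n : ℕ, term χ (n + M) 1) :=
    ((summable_nat_add_iff M).mpr (summable_term χ hχ h1)).hasSum
  have hdiff : HasSum (fun n => (partialSum χ M - partialSum χ (n + M + 1)) * ((c n : ℝ) : ℂ))
      (partialSum χ M * ((M + 1 : ℕ) : ℂ)⁻¹ - ∑' n : ℕ, term χ (n + M) 1) := by
    have h := hS.sub hT
    have hfg : ∀ n, partialSum χ M * ((c n : ℝ) : ℂ) - term χ (n + M) 1 =
        (partialSum χ M - partialSum χ (n + M + 1)) * ((c n : ℝ) : ℂ) := fun n => by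
      rw [hterm]; ring
    simp only [hfg] at h
    exact h
  rw [← hdiff.tsum_eq, div_eq_mul_one_div]
  refine tsum_of_norm_bounded (hcsum.mul_left P) fun n => ?_
  rw [norm_mul, Complex.norm_real, Real.norm_of_nonneg (hc0 n)]
  exact mul_le_mul_of_nonneg_right (norm_partialSum_sub_le_of_interval χ hP _ _) (hc0 n)

/-! ### The tail of `∑ χ(n) log n/n` with the interval bound -/

/-- **`‖∑_{d=1}^{M} χ(d) log d/d + L'(1,χ)‖ ≤ P·log(M+1)/(M+1)`** for `χ ≠ χ₀`, `M ≥ 2`, all interval sums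
bounded by `P` (Abel's inequality with the weight `log d/d`, non-increasing from `3 > e` on).
[cite: Pintz1976ElementaryII, Lemma 1 (proof, p. 280)] [cite: MontgomeryVaughan2007, §11.2.1 Exercise 3(b)] -/
theorem norm_sum_Icc_log_div_add_deriv_le_interval (hχ : χ ≠ 1) {P : ℝ}
    (hP : ∀ a b : ℕ, ‖∑ k ∈ Ioc a b, χ (k : ZMod q)‖ ≤ P) {M : ℕ} (hM : 2 ≤ M) :
    ‖(∑ d ∈ Icc 1 M, χ (d : ZMod q) * ((Real.log d / d : ℝ) : ℂ)) + deriv χ.LFunction 1‖ ≤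
      P * (Real.log ((M : ℝ) + 1) / ((M : ℝ) + 1)) := by
  have hP0 := interval_bound_nonneg χ hP
  set F : ℕ → ℂ := fun m => Complex.log (m : ℂ) / (m : ℂ) with hF
  set f : ℕ → ℝ := fun m => Real.log (m : ℝ) / (m : ℝ) with hf
  have hFf : ∀ m : ℕ, F m = ((f m : ℝ) : ℂ) := fun m => by
    simp only [hF, hf]; exact log_div_natCast m
  -- the finite sum in the Abel-ready form
  have hsumIcc : ∑ d ∈ Icc 1 M, χ (d : ZMod q) * ((Real.log d / d : ℝ) : ℂ) =
      ∑ n ∈ range M, χ ((n + 1 : ℕ) : ZMod q) * F (n + 1) := by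
    rw [sum_Icc_one_eq_sum_range]
    refine sum_congr rfl fun n _ => ?_
    rw [hFf]
  have habel := sum_apply_mul_eq_abel χ F M
  have hterms : ∑ n ∈ range M, partialSum χ (n + 1) * (F (n + 1) - F (n + 2)) =
      -∑ n ∈ range M, deriv (term χ n) 1 := by
    rw [← sum_neg_distrib]
    refine sum_congr rfl fun n _ => ?_
    rw [deriv_term_one, neg_neg]
  have h1 : (0 : ℝ) < (1 : ℂ).re := by simp
  have hL : deriv χ.LFunction 1 = (∑ n ∈ range M, deriv (term χ n) 1) +
      ∑' n : ℕ, deriv (term χ (n + M)) 1 := by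
    rw [deriv_LFunction_one_eq_tsum χ hχ]
    exact ((summable_deriv_term χ hχ h1).sum_add_tsum_nat_add M).symm
  rw [hsumIcc, habel, hterms, hL]
  have hcalc : partialSum χ M * F (M + 1) + -∑ n ∈ range M, deriv (term χ n) 1 +
      ((∑ n ∈ range M, deriv (term χ n) 1) + ∑' n : ℕ, deriv (term χ (n + M)) 1) =
      partialSum χ M * F (M + 1) + ∑' n : ℕ, deriv (term χ (n + M)) 1 := by ring
  rw [hcalc]
  -- the real telescoping weights `Δ n = f(n+M+1) − f(n+M+2) ≥ 0`
  set Δ : ℕ → ℝ := fun n => f (n + M + 1) - f (n + M + 2) with hΔ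
  have hΔ0 : ∀ n, 0 ≤ Δ n := fun n => by
    simp only [hΔ, hf]
    exact log_div_self_sub_nonneg (by exact_mod_cast (by omega : 3 ≤ n + M + 1))
      (by exact_mod_cast (by omega : n + M + 1 ≤ n + M + 2))
  have hf0 : ∀ m : ℕ, 1 ≤ m → 0 ≤ f m := fun m hm => by
    simp only [hf]
    exact div_nonneg (Real.log_nonneg (by exact_mod_cast hm)) (Nat.cast_nonneg m)
  have htel : ∀ K, ∑ n ∈ range K, Δ n = f (M + 1) - f (K + M + 1) := by
    intro K
    induction K with
    | zero => simp [hΔ]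
    | succ K ih =>
      rw [sum_range_succ, ih, hΔ]
      simp only
      rw [show K + M + 2 = K + 1 + M + 1 by ring]
      ring
  have hbound : ∀ K, ∑ n ∈ range K, Δ n ≤ f (M + 1) := fun K => by
    rw [htel]; linarith [hf0 (K + M + 1) (by omega)]
  have hΔs : Summable Δ := summable_of_sum_range_le hΔ0 hbound
  set σ : ℝ := ∑' n, Δ n with hσ
  have hσle : σ ≤ f (M + 1) := Real.tsum_le_of_sum_range_le hΔ0 hbound
  have hσ0 : 0 ≤ σ := tsum_nonneg hΔ0
  -- `deriv (term χ (n+M)) 1 = −S(n+M+1) Δ n`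
  have hder : ∀ n, deriv (term χ (n + M)) 1 = -(partialSum χ (n + M + 1) * ((Δ n : ℝ) : ℂ)) := by
    intro n
    rw [deriv_term_one]
    simp only [hΔ, hf]
    rw [log_div_natCast, log_div_natCast, show n + M + 2 = n + M + 1 + 1 by ring]
    push_cast
    ring_nf
  -- decomposition: `S(M) F(M+1) + Σ' deriv = S(M)(f(M+1) − σ) + Σ' (S(M) − S(n+M+1)) Δ n`
  have hSΔ : HasSum (fun n => partialSum χ M * ((Δ n : ℝ) : ℂ)) (partialSum χ M * ((σ : ℝ) : ℂ)) :=
    (Complex.hasSum_ofReal.mpr hΔs.hasSum).mul_left (partialSum χ M)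
  have hD : HasSum (fun n => deriv (term χ (n + M)) 1) (∑' n : ℕ, deriv (term χ (n + M)) 1) :=
    ((summable_nat_add_iff M).mpr (summable_deriv_term χ hχ h1)).hasSum
  have hmain : HasSum (fun n => (partialSum χ M - partialSum χ (n + M + 1)) * ((Δ n : ℝ) : ℂ))
      (partialSum χ M * ((σ : ℝ) : ℂ) + ∑' n : ℕ, deriv (term χ (n + M)) 1) := by
    have h := hSΔ.add hD
    have hfg : ∀ n, partialSum χ M * ((Δ n : ℝ) : ℂ) + deriv (term χ (n + M)) 1 =
        (partialSum χ M - partialSum χ (n + M + 1)) * ((Δ n : ℝ) : ℂ) := fun n => by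
      rw [hder]; ring
    simp only [hfg] at h
    exact h
  have hid : partialSum χ M * F (M + 1) + ∑' n : ℕ, deriv (term χ (n + M)) 1 =
      partialSum χ M * (((f (M + 1) - σ : ℝ) : ℂ)) +
        ∑' n : ℕ, (partialSum χ M - partialSum χ (n + M + 1)) * ((Δ n : ℝ) : ℂ) := by
    rw [hmain.tsum_eq, hFf]; push_cast; ring
  rw [hid]
  have hA : ‖partialSum χ M * (((f (M + 1) - σ : ℝ) : ℂ))‖ ≤ P * (f (M + 1) - σ) := by
    rw [norm_mul, Complex.norm_real, Real.norm_of_nonneg (by linarith)]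
    exact mul_le_mul_of_nonneg_right (norm_partialSum_le_of_interval χ hP M) (by linarith)
  have hB : ‖∑' n : ℕ, (partialSum χ M - partialSum χ (n + M + 1)) * ((Δ n : ℝ) : ℂ)‖ ≤ P * σ := by
    refine tsum_of_norm_bounded (hΔs.hasSum.mul_left P) fun n => ?_
    rw [norm_mul, Complex.norm_real, Real.norm_of_nonneg (hΔ0 n)]
    exact mul_le_mul_of_nonneg_right (norm_partialSum_sub_le_of_interval χ hP _ _) (hΔ0 n)
  calc ‖partialSum χ M * (((f (M + 1) - σ : ℝ) : ℂ)) +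
        ∑' n : ℕ, (partialSum χ M - partialSum χ (n + M + 1)) * ((Δ n : ℝ) : ℂ)‖
      ≤ P * (f (M + 1) - σ) + P * σ := (norm_add_le _ _).trans (add_le_add hA hB)
    _ = P * f (M + 1) := by ring
    _ = P * (Real.log ((M : ℝ) + 1) / ((M : ℝ) + 1)) := by simp only [hf]; push_cast; ring

/-! ### Abel's inequality on an interval -/

omit [NeZero q] in
/-- **Abel's inequality with the interval bound**: for a real weight `f` with
`f(Y+1) ≥ f(Y+2) ≥ … ≥ f(N+1) ≥ 0`, `‖∑_{Y < d ≤ N} χ(d) f(d)‖ ≤ P·f(Y+1)`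
(`∑ χ(d)f(d) = ∑_{Y<d≤N} T(d)(f(d) − f(d+1)) + T(N) f(N+1)`, `T(d) = ∑_{Y<k≤d} χ(k)`, `‖T‖ ≤ P`).
[cite: Pintz1976ElementaryII, Lemma 1 (proof, p. 280: "applying Abel's inequality")]
[cite: MontgomeryVaughan2007, §1.3 Thm 1.3] -/
theorem norm_sum_Ioc_mul_le_of_antitone {P : ℝ}
    (hP : ∀ a b : ℕ, ‖∑ k ∈ Ioc a b, χ (k : ZMod q)‖ ≤ P) (f : ℕ → ℝ) {Y N : ℕ} (hYN : Y ≤ N)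
    (hmono : ∀ d, Y < d → d ≤ N → f (d + 1) ≤ f d) (hfN : 0 ≤ f (N + 1)) :
    ‖∑ d ∈ Ioc Y N, χ (d : ZMod q) * ((f d : ℝ) : ℂ)‖ ≤ P * f (Y + 1) := by
  have hP0 := interval_bound_nonneg χ hP
  -- Abel's identity on `(Y, N]`
  set T : ℕ → ℂ := fun d => ∑ k ∈ Ioc Y d, χ (k : ZMod q) with hT
  have habel : ∀ N', Y ≤ N' → ∑ d ∈ Ioc Y N', χ (d : ZMod q) * ((f d : ℝ) : ℂ) =
      ∑ d ∈ Ioc Y N', T d * (((f d - f (d + 1) : ℝ) : ℂ)) + T N' * ((f (N' + 1) : ℝ) : ℂ) := by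
    intro N' hN'
    induction N' with
    | zero =>
      have hY : Y = 0 := by omega
      subst hY; simp [hT]
    | succ N' ih =>
      rcases Nat.lt_or_ge Y (N' + 1) with hlt | hge
      · have hY : Y ≤ N' := by omega
        have hTsucc : T (N' + 1) = T N' + χ ((N' + 1 : ℕ) : ZMod q) := by
          simp only [hT]; rw [Finset.sum_Ioc_succ_top (by omega)]
        rw [Finset.sum_Ioc_succ_top (by omega), Finset.sum_Ioc_succ_top (by omega), ih hY, hTsucc]
        push_cast
        ring
      · have hY : Y = N' + 1 := by omega
        subst hY; simp [hT]
  rw [habel N hYN]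
  -- bound term by term
  have hterm : ∀ d ∈ Ioc Y N, ‖T d * (((f d - f (d + 1) : ℝ) : ℂ))‖ ≤ P * (f d - f (d + 1)) := by
    intro d hd
    rw [mem_Ioc] at hd
    have hnn : 0 ≤ f d - f (d + 1) := by linarith [hmono d hd.1 hd.2]
    rw [norm_mul, Complex.norm_real, Real.norm_of_nonneg hnn]
    exact mul_le_mul_of_nonneg_right (hP Y d) hnn
  have hlast : ‖T N * ((f (N + 1) : ℝ) : ℂ)‖ ≤ P * f (N + 1) := by
    rw [norm_mul, Complex.norm_real, Real.norm_of_nonneg hfN]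
    exact mul_le_mul_of_nonneg_right (hP Y N) hfN
  -- telescoping
  have htel : ∀ N', Y ≤ N' → ∑ d ∈ Ioc Y N', (f d - f (d + 1)) = f (Y + 1) - f (N' + 1) := by
    intro N' hN'
    induction N' with
    | zero => have hY : Y = 0 := by omega
              subst hY; simp
    | succ N' ih =>
      rcases Nat.lt_or_ge Y (N' + 1) with hlt | hge
      · rw [Finset.sum_Ioc_succ_top (by omega), ih (by omega)]; ring
      · have hY : Y = N' + 1 := by omega
        subst hY; simp
  calc ‖∑ d ∈ Ioc Y N, T d * (((f d - f (d + 1) : ℝ) : ℂ)) + T N * ((f (N + 1) : ℝ) : ℂ)‖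
      ≤ ∑ d ∈ Ioc Y N, ‖T d * (((f d - f (d + 1) : ℝ) : ℂ))‖ + ‖T N * ((f (N + 1) : ℝ) : ℂ)‖ :=
        (norm_add_le _ _).trans (add_le_add (norm_sum_le _ _) le_rfl)
    _ ≤ ∑ d ∈ Ioc Y N, P * (f d - f (d + 1)) + P * f (N + 1) := add_le_add (sum_le_sum hterm) hlast
    _ = P * f (Y + 1) := by rw [← mul_sum, htel N hYN]; ring

/-! ### The harmonic remainder with the constant `2` -/

/-- `|H(⌊x⌋/d) − (log x − log d + γ)| ≤ 2d/x` for `1 ≤ d ≤ x`: with `k = ⌊x/d⌋ ≥ 1`, Mathlib's envelopes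
`H(k) − log(k+1) < γ < H(k) − log k` and `log k ≤ log(x/d) < log(k+1)` give `|…| ≤ log((k+1)/k) ≤ 1/k ≤ 2d/x`
(`x < (k+1)d ≤ 2kd`). [folklore] -/
private theorem abs_harmonic_floor_div_sub_le {d : ℕ} {x : ℝ} (hd : 1 ≤ d) (hdx : (d : ℝ) ≤ x) :
    |(harmonic (⌊x⌋₊ / d) : ℝ) - (Real.log x - Real.log d + Real.eulerMascheroniConstant)| ≤
      2 * (d : ℝ) / x := by
  set k := ⌊x⌋₊ / d with hk
  have hd0 : (0 : ℝ) < d := by exact_mod_cast hd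
  have hx0 : 0 < x := lt_of_lt_of_le hd0 hdx
  have hdN : d ≤ ⌊x⌋₊ := Nat.le_floor hdx
  have hk1 : 1 ≤ k := (Nat.le_div_iff_mul_le hd).mpr (by simpa using hdN)
  have hk0 : (0 : ℝ) < k := by exact_mod_cast hk1
  have hkle : (k : ℝ) * d ≤ x := by
    have h1 : ((k * d : ℕ) : ℝ) ≤ ⌊x⌋₊ := by exact_mod_cast Nat.div_mul_le_self ⌊x⌋₊ d
    push_cast at h1
    exact h1.trans (Nat.floor_le hx0.le)
  have hklt : x < (k : ℝ) * d + d := by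
    have h1 : ⌊x⌋₊ < k * d + d := by
      have := Nat.lt_div_mul_add (a := ⌊x⌋₊) hd
      rwa [← hk] at this
    have h2 : x < (⌊x⌋₊ : ℝ) + 1 := Nat.lt_floor_add_one x
    have h3 : ((⌊x⌋₊ : ℕ) : ℝ) + 1 ≤ ((k * d + d : ℕ) : ℝ) := by exact_mod_cast h1
    push_cast at h3
    linarith
  -- `1/k ≤ 2d/x`
  have hinv : 1 / (k : ℝ) ≤ 2 * d / x := by
    rw [div_le_div_iff₀ hk0 hx0]
    have : (d : ℝ) ≤ k * d := le_mul_of_one_le_left hd0.le (by exact_mod_cast hk1)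
    nlinarith
  -- `log k ≤ log x − log d ≤ log (k+1) ≤ log k + 1/k`
  have hlog1 : Real.log k ≤ Real.log x - Real.log d := by
    rw [← Real.log_div hx0.ne' hd0.ne']
    exact Real.log_le_log hk0 (by rw [le_div_iff₀ hd0]; exact hkle)
  have hlog2 : Real.log x - Real.log d ≤ Real.log ((k : ℝ) + 1) := by
    rw [← Real.log_div hx0.ne' hd0.ne']
    exact Real.log_le_log (by positivity) (by rw [div_le_iff₀ hd0]; linarith)
  have hlog3 : Real.log ((k : ℝ) + 1) - Real.log k ≤ 1 / (k : ℝ) := by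
    rw [← Real.log_div (by positivity) hk0.ne']
    have := Real.log_le_sub_one_of_pos (x := ((k : ℝ) + 1) / k) (by positivity)
    rw [div_sub_one hk0.ne', add_sub_cancel_left] at this
    exact this
  -- the envelopes
  have h1 := Real.eulerMascheroniConstant_lt_eulerMascheroniSeq' k
  rw [Real.eulerMascheroniSeq', if_neg (by omega)] at h1
  have h2 := Real.eulerMascheroniSeq_lt_eulerMascheroniConstant k
  rw [Real.eulerMascheroniSeq] at h2
  rw [abs_le]
  constructor <;> linarith

omit [NeZero q] in
/-- The head of the hyperbola sum with the constant `2`, for real `x ≥ Y`: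
`‖∑_{d ≤ Y} (χ(d)/d)H(⌊x/d⌋) − ((log x + γ)∑_{d ≤ Y} χ(d)/d − ∑_{d ≤ Y} χ(d) log d/d)‖ ≤ 2Y/x`.
[cite: Pintz1976ElementaryII, Lemma 1 (proof, (2.2) p. 279 and `Σ₁` p. 280)] -/
theorem norm_head_sub_le_two {x : ℝ} {Y : ℕ} (hYx : (Y : ℝ) ≤ x) :
    ‖(∑ d ∈ Icc 1 Y, χ (d : ZMod q) / (d : ℂ) * ((harmonic (⌊x⌋₊ / d) : ℝ) : ℂ)) -
        ((Real.log x + Real.eulerMascheroniConstant : ℝ) * ∑ d ∈ Icc 1 Y, χ (d : ZMod q) / (d : ℂ) -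
          ∑ d ∈ Icc 1 Y, χ (d : ZMod q) * ((Real.log d / d : ℝ) : ℂ))‖ ≤ 2 * (Y : ℝ) / x := by
  rw [Finset.mul_sum, ← Finset.sum_sub_distrib, ← Finset.sum_sub_distrib]
  have hterm : ∀ d ∈ Icc 1 Y, ‖χ (d : ZMod q) / (d : ℂ) * ((harmonic (⌊x⌋₊ / d) : ℝ) : ℂ) -
      ((Real.log x + Real.eulerMascheroniConstant : ℝ) * (χ (d : ZMod q) / (d : ℂ)) -
        χ (d : ZMod q) * ((Real.log d / d : ℝ) : ℂ))‖ ≤ 2 / x := by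
    intro d hd
    rw [mem_Icc] at hd
    have hd0 : (d : ℂ) ≠ 0 := by exact_mod_cast (by omega : d ≠ 0)
    have hdpos : (0 : ℝ) < d := by exact_mod_cast hd.1
    have hdx : (d : ℝ) ≤ x := le_trans (by exact_mod_cast hd.2) hYx
    have hx0 : 0 < x := lt_of_lt_of_le hdpos hdx
    have e : χ (d : ZMod q) / (d : ℂ) * ((harmonic (⌊x⌋₊ / d) : ℝ) : ℂ) -
        ((Real.log x + Real.eulerMascheroniConstant : ℝ) * (χ (d : ZMod q) / (d : ℂ)) -
          χ (d : ZMod q) * ((Real.log d / d : ℝ) : ℂ)) =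
        χ (d : ZMod q) / (d : ℂ) *
          (((harmonic (⌊x⌋₊ / d) : ℝ) - (Real.log x - Real.log d + Real.eulerMascheroniConstant) : ℝ) : ℂ) := by
      push_cast
      field_simp
      ring
    rw [e, norm_mul, norm_div, Complex.norm_natCast, Complex.norm_real, Real.norm_eq_abs]
    have h1 : ‖χ (d : ZMod q)‖ ≤ 1 := χ.norm_le_one _
    have h2 := abs_harmonic_floor_div_sub_le hd.1 hdx
    calc ‖χ (d : ZMod q)‖ / (d : ℝ) *
          |(harmonic (⌊x⌋₊ / d) : ℝ) - (Real.log x - Real.log d + Real.eulerMascheroniConstant)|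
        ≤ 1 / (d : ℝ) * (2 * (d : ℝ) / x) := by
          apply mul_le_mul _ h2 (abs_nonneg _) (by positivity)
          exact div_le_div_of_nonneg_right h1 hdpos.le
      _ = 2 / x := by field_simp
  refine (norm_sum_le _ _).trans ((sum_le_sum hterm).trans ?_)
  rw [sum_const, Nat.card_Icc, show Y + 1 - 1 = Y by omega, nsmul_eq_mul]
  ring_nf
  rfl

/-! ### The hyperbola tail by Abel's inequality (Pintz's `Σ₂`) -/

omit [NeZero q] in
/-- The harmonic numbers are non-decreasing. [folklore] -/
private theorem harmonic_mono' {a b : ℕ} (h : a ≤ b) : (harmonic a : ℝ) ≤ harmonic b := by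
  have hq : harmonic a ≤ harmonic b := by
    rw [harmonic_eq_sum_Icc, harmonic_eq_sum_Icc]
    exact sum_le_sum_of_subset_of_nonneg (Icc_subset_Icc_right h) fun _ _ _ => by positivity
  exact_mod_cast hq

omit [NeZero q] in
/-- The harmonic numbers are non-negative. [folklore] -/
private theorem harmonic_nonneg' (n : ℕ) : 0 ≤ (harmonic n : ℝ) := by
  have hq : (0 : ℚ) ≤ harmonic n := by
    rw [harmonic_eq_sum_Icc]; exact sum_nonneg fun _ _ => by positivity
  exact_mod_cast hq

omit [NeZero q] in
/-- **Pintz's `Σ₂`**: `‖∑_{Y < d ≤ N} (χ(d)/d)·H(⌊N/d⌋)‖ ≤ P·(1 + log N − log(Y+1))/(Y+1)` for `Y < N` (Abel's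
inequality with the non-increasing weight `d ↦ H(⌊N/d⌋)/d`, then `H(k) ≤ 1 + log k`, `k = ⌊N/(Y+1)⌋ ≤ N/(Y+1)`).
[cite: Pintz1976ElementaryII, Lemma 1 (proof, p. 280, `|Σ₂|`)] -/
theorem norm_tail_le_interval {P : ℝ}
    (hP : ∀ a b : ℕ, ‖∑ k ∈ Ioc a b, χ (k : ZMod q)‖ ≤ P) {N Y : ℕ} (hYN : Y < N) :
    ‖∑ d ∈ (Icc 1 N).filter (fun d => Y < d), χ (d : ZMod q) / (d : ℂ) * ((harmonic (N / d) : ℝ) : ℂ)‖ ≤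
      P * ((1 + Real.log N - Real.log ((Y : ℝ) + 1)) / ((Y : ℝ) + 1)) := by
  have hP0 := interval_bound_nonneg χ hP
  set f : ℕ → ℝ := fun d => (harmonic (N / d) : ℝ) / d with hf
  -- the filtered sum is the `Ioc Y N` sum of `χ(d) f(d)`
  have hset : (Icc 1 N).filter (fun d => Y < d) = Ioc Y N := by
    ext d; simp only [mem_filter, mem_Icc, mem_Ioc]; omega
  have hsum : ∑ d ∈ (Icc 1 N).filter (fun d => Y < d), χ (d : ZMod q) / (d : ℂ) * ((harmonic (N / d) : ℝ) : ℂ) =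
      ∑ d ∈ Ioc Y N, χ (d : ZMod q) * ((f d : ℝ) : ℂ) := by
    rw [hset]
    refine sum_congr rfl fun d hd => ?_
    simp only [hf]
    push_cast
    ring
  rw [hsum]
  -- monotonicity of the weight
  have hmono : ∀ d, Y < d → d ≤ N → f (d + 1) ≤ f d := by
    intro d hd _
    simp only [hf]
    have hd0 : (0 : ℝ) < d := by exact_mod_cast (by omega : 0 < d)
    have hH : (harmonic (N / (d + 1)) : ℝ) ≤ harmonic (N / d) :=
      harmonic_mono' (Nat.div_le_div_left (Nat.le_succ d) (by omega))
    have hH0 : 0 ≤ (harmonic (N / (d + 1)) : ℝ) := harmonic_nonneg' _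
    push_cast
    calc (harmonic (N / (d + 1)) : ℝ) / ((d : ℝ) + 1) ≤ (harmonic (N / (d + 1)) : ℝ) / d :=
          div_le_div_of_nonneg_left hH0 hd0 (by linarith)
      _ ≤ (harmonic (N / d) : ℝ) / d := div_le_div_of_nonneg_right hH hd0.le
  have hfN : 0 ≤ f (N + 1) := by
    simp only [hf]
    rw [Nat.div_eq_of_lt (Nat.lt_succ_self N), harmonic_zero]
    simp
  have habel := norm_sum_Ioc_mul_le_of_antitone χ hP f hYN.le hmono hfN
  refine habel.trans (mul_le_mul_of_nonneg_left ?_ hP0)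
  -- `f(Y+1) = H(⌊N/(Y+1)⌋)/(Y+1) ≤ (1 + log N − log(Y+1))/(Y+1)`
  simp only [hf]
  push_cast
  refine div_le_div_of_nonneg_right ?_ (by positivity)
  set k := N / (Y + 1) with hk
  have hk1 : 1 ≤ k := (Nat.le_div_iff_mul_le (Nat.succ_pos Y)).mpr (by simpa using hYN)
  have hk0 : (0 : ℝ) < k := by exact_mod_cast hk1
  have hN0 : (0 : ℝ) < N := by exact_mod_cast (show 0 < N by omega)
  have h1 := harmonic_le_one_add_log k
  have h2 : Real.log k ≤ Real.log N - Real.log ((Y : ℝ) + 1) := by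
    rw [← Real.log_div hN0.ne' (by positivity)]
    refine Real.log_le_log hk0 ?_
    have := Nat.cast_div_le (m := N) (n := Y + 1) (α := ℝ)
    push_cast at this
    exact this
  linarith

/-! ### The sharp hyperbola estimate -/

/-- **`∑_{n ≤ x} (1 ∗ χ)(n)/n = (log x + γ)L(1,χ) + L'(1,χ) + ϑ·(P(2 log x + γ + 1)/(Y+1) + 2Y/x)`** for real
`x`: for `χ ≠ χ₀` mod `q` with all interval sums `|∑_{a < k ≤ b} χ(k)| ≤ P` and an integer `2 ≤ Y ≤ x`,
`‖∑_{n ≤ x} r(n)/n − ((log x + γ)L(1,χ) + L'(1,χ))‖ ≤ P(2 log x + γ + 1)/(Y+1) + 2Y/x` (`r = 1 ∗ χ`;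
Pintz's four terms `(log x + c)P/z`, `P log z/z`, `z/x`-type and `Σ₂`, the `log(Y+1)` parts cancelling).
[cite: Pintz1976ElementaryII, Lemma 1 (proof, pp. 279–280)] [cite: MontgomeryVaughan2007, §11.2.1 Exercise 3(g)] -/
theorem norm_sum_divisorSum_div_sub_le_interval_real (hχ : χ ≠ 1) {P : ℝ}
    (hP : ∀ a b : ℕ, ‖∑ k ∈ Ioc a b, χ (k : ZMod q)‖ ≤ P) {x : ℝ} {Y : ℕ} (hY : 2 ≤ Y)
    (hYx : (Y : ℝ) ≤ x) :
    ‖(∑ n ∈ Icc 1 ⌊x⌋₊, (∑ d ∈ n.divisors, χ (d : ZMod q)) / (n : ℂ)) -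
        (((Real.log x + Real.eulerMascheroniConstant : ℝ) : ℂ) * χ.LFunction 1 +
          deriv χ.LFunction 1)‖ ≤
      P * (2 * Real.log x + Real.eulerMascheroniConstant + 1) / ((Y : ℝ) + 1) + 2 * (Y : ℝ) / x := by
  have hP0 := interval_bound_nonneg χ hP
  set N := ⌊x⌋₊ with hN
  have hx2 : (2 : ℝ) ≤ x := le_trans (by exact_mod_cast hY) hYx
  have hx0 : 0 < x := by linarith
  have hYN : Y ≤ N := Nat.le_floor hYx
  have hN1 : 1 ≤ N := le_trans (by omega) hYN
  have hNx : (N : ℝ) ≤ x := Nat.floor_le hx0.le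
  have hN0 : (0 : ℝ) < N := by exact_mod_cast hN1
  have hlogNx : Real.log N ≤ Real.log x := Real.log_le_log hN0 hNx
  have hlogx : 0 ≤ Real.log x := Real.log_nonneg (by linarith)
  have hγ0 : 0 ≤ Real.eulerMascheroniConstant :=
    (by norm_num : (0 : ℝ) ≤ 1 / 2).trans Real.one_half_lt_eulerMascheroniConstant.le
  have hY0 : (0 : ℝ) < (Y : ℝ) + 1 := by positivity
  have hlogY : Real.log ((Y : ℝ) + 1) ≤ Real.log x + 1 := by
    have h1 : Real.log ((Y : ℝ) + 1) ≤ Real.log (x + 1) := Real.log_le_log hY0 (by linarith)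
    have h2 : Real.log (x + 1) - Real.log x ≤ 1 / x := by
      rw [← Real.log_div (by linarith) hx0.ne']
      have := Real.log_le_sub_one_of_pos (x := (x + 1) / x) (by positivity)
      rw [div_sub_one hx0.ne', add_sub_cancel_left] at this
      exact this
    have h3 : 1 / x ≤ 1 := by rw [div_le_one hx0]; linarith
    linarith
  -- notation
  set a : ℕ → ℂ := fun d => χ (d : ZMod q) / (d : ℂ) with ha
  set Hh : ℕ → ℂ := fun k => ((harmonic k : ℝ) : ℂ) with hHh
  set L : ℂ := χ.LFunction 1 with hLdef
  set L' : ℂ := deriv χ.LFunction 1 with hL'def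
  set c : ℝ := Real.log x + Real.eulerMascheroniConstant with hc
  have hc0 : 0 ≤ c := add_nonneg hlogx hγ0
  set AY : ℂ := ∑ d ∈ Icc 1 Y, a d with hAY
  set LY : ℂ := ∑ d ∈ Icc 1 Y, χ (d : ZMod q) * ((Real.log d / d : ℝ) : ℂ) with hLY
  set head : ℂ := ∑ d ∈ Icc 1 Y, a d * Hh (N / d) with hhead
  set tail : ℂ := ∑ d ∈ (Icc 1 N).filter (fun d => Y < d), a d * Hh (N / d) with htail
  -- the hyperbola identity and the split at `Y`
  have hT : ∑ n ∈ Icc 1 N, (∑ d ∈ n.divisors, χ (d : ZMod q)) / (n : ℂ) = head + tail := by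
    rw [sum_divisorSum_div_eq, hhead, htail,
      ← Finset.sum_filter_add_sum_filter_not (Icc 1 N) (fun d => d ≤ Y)]
    congr 1
    · refine sum_congr ?_ fun _ _ => rfl
      ext d; simp only [mem_filter, mem_Icc]; omega
    · refine sum_congr ?_ fun _ _ => rfl
      ext d; simp only [mem_filter, mem_Icc, not_le]
  -- the four error terms
  have e1 : ‖AY - L‖ ≤ P / ((Y : ℝ) + 1) := norm_sum_Icc_div_sub_LFunction_one_le_interval χ hχ hP Y
  have e2 : ‖LY + L'‖ ≤ P * (Real.log ((Y : ℝ) + 1) / ((Y : ℝ) + 1)) :=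
    norm_sum_Icc_log_div_add_deriv_le_interval χ hχ hP hY
  have e3 : ‖head - ((c : ℂ) * AY - LY)‖ ≤ 2 * (Y : ℝ) / x := norm_head_sub_le_two χ hYx
  have e4 : ‖tail‖ ≤ P * ((1 + Real.log x - Real.log ((Y : ℝ) + 1)) / ((Y : ℝ) + 1)) := by
    rcases lt_or_ge Y N with hlt | hge
    · refine (norm_tail_le_interval χ hP hlt).trans (mul_le_mul_of_nonneg_left ?_ hP0)
      refine div_le_div_of_nonneg_right ?_ hY0.le
      linarith
    · have hempty : (Icc 1 N).filter (fun d => Y < d) = ∅ := by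
        ext d; simp only [mem_filter, mem_Icc, Finset.notMem_empty, iff_false]; omega
      rw [htail, hempty, sum_empty, norm_zero]
      refine mul_nonneg hP0 (div_nonneg ?_ hY0.le)
      linarith
  -- combine
  have hdecomp : head + tail - ((c : ℂ) * L + L') =
      (c : ℂ) * (AY - L) - (LY + L') + (head - ((c : ℂ) * AY - LY)) + tail := by ring
  rw [hT, hdecomp]
  have hcn : ‖(c : ℂ) * (AY - L)‖ ≤ c * (P / ((Y : ℝ) + 1)) := by
    rw [norm_mul, Complex.norm_real, Real.norm_eq_abs, abs_of_nonneg hc0]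
    exact mul_le_mul_of_nonneg_left e1 hc0
  calc ‖(c : ℂ) * (AY - L) - (LY + L') + (head - ((c : ℂ) * AY - LY)) + tail‖
      ≤ ‖(c : ℂ) * (AY - L)‖ + ‖LY + L'‖ + ‖head - ((c : ℂ) * AY - LY)‖ + ‖tail‖ := by
        refine (norm_add_le _ _).trans (add_le_add ((norm_add_le _ _).trans
          (add_le_add ((norm_sub_le _ _).trans le_rfl) le_rfl)) le_rfl)
    _ ≤ c * (P / ((Y : ℝ) + 1)) + P * (Real.log ((Y : ℝ) + 1) / ((Y : ℝ) + 1)) +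
          2 * (Y : ℝ) / x + P * ((1 + Real.log x - Real.log ((Y : ℝ) + 1)) / ((Y : ℝ) + 1)) :=
        add_le_add (add_le_add (add_le_add hcn e2) e3) e4
    _ = P * (2 * Real.log x + Real.eulerMascheroniConstant + 1) / ((Y : ℝ) + 1) + 2 * (Y : ℝ) / x := by
        rw [hc]; field_simp; ring

/-- The same at an integer `x = N`: for `χ ≠ χ₀` mod `q`, `|∑_{a < k ≤ b} χ(k)| ≤ P`, `2 ≤ Y ≤ N`,
`‖∑_{n=1}^{N} r(n)/n − ((log N + γ)L(1,χ) + L'(1,χ))‖ ≤ P(2 log N + γ + 1)/(Y+1) + 2Y/N`.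
[cite: Pintz1976ElementaryII, Lemma 1 (proof, pp. 279–280)] [cite: MontgomeryVaughan2007, §11.2.1 Exercise 3(g)] -/
theorem norm_sum_divisorSum_div_sub_le_interval (hχ : χ ≠ 1) {P : ℝ}
    (hP : ∀ a b : ℕ, ‖∑ k ∈ Ioc a b, χ (k : ZMod q)‖ ≤ P) {N Y : ℕ} (hY : 2 ≤ Y) (hYN : Y ≤ N) :
    ‖(∑ n ∈ Icc 1 N, (∑ d ∈ n.divisors, χ (d : ZMod q)) / (n : ℂ)) -
        (((Real.log N + Real.eulerMascheroniConstant : ℝ) : ℂ) * χ.LFunction 1 +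
          deriv χ.LFunction 1)‖ ≤
      P * (2 * Real.log N + Real.eulerMascheroniConstant + 1) / ((Y : ℝ) + 1) + 2 * (Y : ℝ) / N := by
  have h := norm_sum_divisorSum_div_sub_le_interval_real χ hχ hP (x := (N : ℝ)) hY
    (by exact_mod_cast hYN)
  rwa [Nat.floor_natCast] at h

end Literature.NumberTheory.LFunctions.DirichletAbel

end
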